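import Summits.FinalStateConjecture.FinalStateConjecture.Theses.ClusterCompleteness
import Literature.Geometry.Lorentzian.CoordCurvature
import Literature.Geometry.Lorentzian.KerrSchildChartCovariance
import Literature.Geometry.Lorentzian.KerrRadiusGradientVector
import HarnessLib

/-!
# Crux `ClusterCompleteness.OmegaLimitMultiKerr` (stmt-FinalStateConjecture-17639), line `Sketch` —
# red-shift rigidity at an EXTREMAL label (helper for stub `stub_redShiftExcludesExtremalRecurrence`)

Support file (everything proved) for child 1 `GenericTameNonExtremalEra` of the typed split of the crux
(`Cruxes/OmegaLimitMultiKerr/DECOMPOSITION.md`, skeleton `Lines/Sketch.lean`): the LABEL-LOCAL endgame of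
the red-shift mechanism behind `NoExtremalRecurrence`. In the crux's currency a hole chart
`Ψ : boostedKerrExterior Λ c M a → 𝓢` has chart metric `G = deviationExtend + boostedKerrBilin` (lab
Kerr–Schild coordinates, `KerrConvergence.lean`), red-shift scalar `dr(G♯dr)` with
`r = Kerr.radius a ∘ poincareInv Λ c` and `♯ = MetricCoord.sharpAt` (`CoordCurvature.lean`), and the
UNIFORM RED-SHIFT clause of a tame era reads `κ₀ (r − r₊) ≤ dr(G♯dr)` on the collar slab
`{t* = τ, r ≤ r₊ + δ}`.

Main statement `extremal_redShift_near_label_false`: for an EXTREMAL closed label `|a| = M > 0`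
(`r₊ = M`, `Δ = (r − M)²`), a motion `Λ` and constants `κ₀, δ > 0` there is ONE tolerance
`ε = ε(Λ, M, a, κ₀, δ) > 0` such that no chart of any spacetime modelled on the boosted exterior
`(Λ, c, M, a)` has, at any single chart time `τ`, both the red-shift inequality on the collar slab and
`‖G − g_B‖ ≤ ε` pointwise there. Hence (order `0` of) recurrence `truncDeviationCk … R' τ ≤ ε`,
`R' ≥ r₊ + δ`, at ONE time where the red-shift clause holds already excludes the extremal label
(`norm_deviationExtend_le_of_truncDeviationCk_le` converts the sup-norm bound to the pointwise one).

Proof: at the boosted polar point `x = Λ(τ, 0, 0, M + s) + c`, `s = min δ (κ₀ M²/2)` (section 2: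
its rest-frame time, radius, membership, and the STATIONARITY of `g_B(x)` and of `dr_x` in `τ` and
`c`), the label value of the red-shift scalar is `dr(g_B♯dr) = g(W, W) = Δ/Σ = s²/Σ ≤ s²/M² ≤ κ₀ s/2`
(`Kerr.bilin_radiusGradVector_self`, `Kerr.sq_le_blSigma`; `W = Kerr.radiusGradVector`, `g_B(ΛW) = dr`
by `Kerr.bilin_radiusGradVector`), the map `B ↦ dr(B⁻¹dr)` is continuous at the invertible `g_B(x)`
(section 1, inversion of continuous linear maps), so `‖G(x) − g_B(x)‖ ≤ ε` forces
`dr(G♯dr) < s²/Σ + κ₀ s/2 ≤ κ₀ s`, against the red-shift `κ₀ s ≤ dr(G♯dr)`.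

## References

* B. O'Neill, *The Geometry of Kerr Black Holes*, A K Peters 1995, §2.4–§2.5 (`Δ`, `r₊`, `grad r`).
* M. Dafermos, I. Rodnianski, Y. Shlapentokh-Rothman, arXiv:1402.7034, §2.1.1 (`Δ`, `Σ`).
* M. Dafermos, G. Holzegel, I. Rodnianski, M. Taylor, arXiv:2104.08222, §1 (deviation sup norms).
* R. P. Kerr, A. Schild (1965), §2 (stationarity and Lorentz covariance of the Kerr–Schild form).
-/

set_option linter.dupNamespace false

noncomputable section

open scoped Manifold ContDiff Topology ENNReal
open Set Filter Function TopologicalSpace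

namespace Summit.FinalStateConjecture.FinalStateConjecture.Theorems.ClusterCompleteness

open Literature.Geometry.Lorentzian

/-! ### 1. Perturbation of the raised square `α(B⁻¹α)` -/

/-- **The raised square `α(B⁻¹ α)` is continuous in the form `B` at an invertible form `A`**
(inversion of continuous linear maps is continuous at invertible maps; finite dimension):
for every `γ > 0` there is `η > 0` with `|α(B⁻¹α) − α(A⁻¹α)| < γ` whenever `‖B − A‖ < η`.
[folklore] -/
theorem exists_inverse_apply_near {A : E4 →L[ℝ] E4 →L[ℝ] ℝ} (hA : A.IsInvertible)
    (α : E4 →L[ℝ] ℝ) {γ : ℝ} (hγ : 0 < γ) :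
    ∃ η : ℝ, 0 < η ∧ ∀ B : E4 →L[ℝ] E4 →L[ℝ] ℝ, ‖B - A‖ < η →
      |α (B.inverse α) - α (A.inverse α)| < γ := by
  have h1 : ContinuousAt
      (ContinuousLinearMap.inverse : (E4 →L[ℝ] E4 →L[ℝ] ℝ) → ((E4 →L[ℝ] ℝ) →L[ℝ] E4)) A :=
    (hA.contDiffAt_map_inverse (n := 0)).continuousAt
  have h2 : ContinuousAt (fun B : E4 →L[ℝ] E4 →L[ℝ] ℝ ↦ B.inverse α) A :=
    h1.clm_apply continuousAt_const
  have h3 : ContinuousAt (fun B : E4 →L[ℝ] E4 →L[ℝ] ℝ ↦ α (B.inverse α)) A :=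
    continuousAt_const.clm_apply h2
  -- the operator-norm metric on `E4 →L E4 →L ℝ` and the strong topology agree definitionally,
  -- but only after the carrier is fixed: pass it explicitly
  have h4 := (Metric.continuousAt_iff (α := E4 →L[ℝ] E4 →L[ℝ] ℝ) (β := ℝ)
    (f := fun B : E4 →L[ℝ] E4 →L[ℝ] ℝ ↦ α (B.inverse α)) (a := A)).mp h3
  obtain ⟨η, hη, h⟩ := h4 γ hγ
  refine ⟨η, hη, fun B hB ↦ ?_⟩
  have hB' : dist B A < η := (dist_eq_norm B A).trans_lt hB
  have := h hB'
  rwa [Real.dist_eq] at this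

/-! ### 2. The Killing orbit of the boosted polar point of an extremal label -/

section PolarOrbit

variable (Λ : lorentzGroup) (c : E4)

/-- Rest-frame coordinates of the orbit point `Λ(r' e₃) + c + τ Λe₀`: `(τ, 0, 0, r')`. [folklore] -/
theorem poincareInv_polarOrbit (r' τ : ℝ) :
    poincareInv Λ c ((Λ : E4 ≃L[ℝ] E4) (r' • E4.basisVector 3) + c +
        τ • (Λ : E4 ≃L[ℝ] E4) (EuclideanSpace.single (0 : Fin 4) (1 : ℝ))) =
      r' • E4.basisVector 3 + τ • E4.basisVector 0 := by
  rw [KerrSchildChart.poincareInv_add_smul, KerrSchildChart.poincareInv_boostedPolar]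

/-- The rest-frame time of the orbit point is `τ`. [folklore] -/
theorem time_polarOrbit (M a r' τ : ℝ) :
    (boostedKerrBackground Λ c M a).time ((Λ : E4 ≃L[ℝ] E4) (r' • E4.basisVector 3) + c +
        τ • (Λ : E4 ≃L[ℝ] E4) (EuclideanSpace.single (0 : Fin 4) (1 : ℝ))) = τ := by
  show poincareInv Λ c _ 0 = τ
  rw [poincareInv_polarOrbit]
  simp

/-- The rest-frame Kerr–Schild radius of the orbit point is `r'` (`r' ≥ 0`). [folklore] -/
theorem radius_polarOrbit (M a : ℝ) {r' : ℝ} (hr' : 0 ≤ r') (τ : ℝ) :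
    (boostedKerrBackground Λ c M a).radius ((Λ : E4 ≃L[ℝ] E4) (r' • E4.basisVector 3) + c +
        τ • (Λ : E4 ≃L[ℝ] E4) (EuclideanSpace.single (0 : Fin 4) (1 : ℝ))) = r' := by
  show Kerr.radius a (poincareInv Λ c _) = r'
  rw [poincareInv_polarOrbit, Kerr.radius_add_time_smul_basisVector, KerrSchildChart.radius_polar a hr']

/-- For an extremal label `|a| = M > 0` and `M < r'` the orbit point lies in the boosted exterior
`{r > r₊ = M}`. [folklore] -/
theorem polarOrbit_mem_domain {M a r' : ℝ} (hext : Kerr.IsExtremal M a) (hr' : M < r') (τ : ℝ) :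
    (Λ : E4 ≃L[ℝ] E4) (r' • E4.basisVector 3) + c +
        τ • (Λ : E4 ≃L[ℝ] E4) (EuclideanSpace.single (0 : Fin 4) (1 : ℝ)) ∈
      (boostedKerrBackground Λ c M a).domain := by
  show _ ∈ boostedKerrExterior Λ c M a
  rw [mem_boostedKerrExterior, poincareInv_polarOrbit, Kerr.mem_exterior,
    Kerr.radius_add_time_smul_basisVector, KerrSchildChart.rPlus_of_abs_eq hext.1,
    KerrSchildChart.radius_polar a (hext.2.trans hr').le]
  exact max_lt hr' (hext.2.trans hr')

/-- Stationarity: the boosted Kerr–Schild form at the orbit point is its value at `Λ(r' e₃)` for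
the untranslated motion (independent of `c` and `τ`). [cite: KerrSchild1965, §2] -/
theorem boostedKerrBilin_polarOrbit (M a r' τ : ℝ) :
    boostedKerrBilin Λ c M a ((Λ : E4 ≃L[ℝ] E4) (r' • E4.basisVector 3) + c +
        τ • (Λ : E4 ≃L[ℝ] E4) (EuclideanSpace.single (0 : Fin 4) (1 : ℝ))) =
      boostedKerrBilin Λ 0 M a ((Λ : E4 ≃L[ℝ] E4) (r' • E4.basisVector 3)) := by
  ext v w
  rw [boostedKerrBilin_apply, boostedKerrBilin_apply, poincareInv_polarOrbit,
    Kerr.bilin_add_smul_basisVector_zero]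
  simp [poincareInv]

/-- The differential of the rest-frame radius `r ∘ Λ⁻¹(· − c)` at the orbit point is the
time-independent covector `dr_{(0,0,0,r')} ∘ Λ⁻¹` (`Kerr.hasFDerivAt_radius`, chain rule). [folklore] -/
theorem fderiv_radius_polarOrbit (a : ℝ) {r' : ℝ} (hr' : 0 < r') (τ : ℝ) :
    fderiv ℝ (fun y ↦ Kerr.radius a (poincareInv Λ c y))
        ((Λ : E4 ≃L[ℝ] E4) (r' • E4.basisVector 3) + c +
          τ • (Λ : E4 ≃L[ℝ] E4) (EuclideanSpace.single (0 : Fin 4) (1 : ℝ))) =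
      ((Kerr.radiusGrad a (E4.spatial (r' • E4.basisVector 3 : E4))).comp E4.spatial).comp
        ((Λ : E4 ≃L[ℝ] E4).symm : E4 →L[ℝ] E4) := by
  set x : E4 := (Λ : E4 ≃L[ℝ] E4) (r' • E4.basisVector 3) + c +
    τ • (Λ : E4 ≃L[ℝ] E4) (EuclideanSpace.single (0 : Fin 4) (1 : ℝ)) with hx
  have hq : poincareInv Λ c x = r' • E4.basisVector 3 + τ • E4.basisVector 0 :=
    poincareInv_polarOrbit Λ c r' τ
  have hr : 0 < Kerr.radius a (poincareInv Λ c x) := by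
    rw [hq, Kerr.radius_add_time_smul_basisVector, KerrSchildChart.radius_polar a hr'.le]
    exact hr'
  have h : HasFDerivAt (fun y ↦ Kerr.radius a (poincareInv Λ c y))
      (((Kerr.radiusGrad a (E4.spatial (poincareInv Λ c x))).comp E4.spatial).comp
        ((Λ : E4 ≃L[ℝ] E4).symm : E4 →L[ℝ] E4)) x :=
    (Kerr.hasFDerivAt_radius hr).comp x (KerrSchildChart.hasFDerivAt_poincareInv Λ c x)
  rw [h.fderiv, hq, Kerr.spatial_add_smul_basisVector_zero]

end PolarOrbit

/-! ### 3. The core lemma: uniform red-shift and `C⁰`-recurrence to an EXTREMAL label are incompatible -/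

/-- Pointwise form of a truncated `Cᵐ` deviation bound: on the truncated slab the extended
deviation has operator norm `≤ ε` (the `m = 0` term of the sup norm). DHRT arXiv:2104.08222, §1.
[folklore] -/
theorem norm_deviationExtend_le_of_truncDeviationCk_le {𝓢 : Spacetime.{0} 4} (B : ModelBackground)
    (Ψ : B.domain → 𝓢.carrier) {m : ℕ} {R τ ε : ℝ} (hε : 0 ≤ ε)
    (h : 𝓢.truncDeviationCk B Ψ m R τ ≤ ENNReal.ofReal ε) {x : B.domain}
    (hx : x ∈ B.truncTimeSlab R τ) : ‖𝓢.deviationExtend B Ψ x‖ ≤ ε := by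
  have h0 := enorm_iteratedFDeriv_le_supCkENorm (Nat.zero_le m) (mem_image_of_mem Subtype.val hx)
    (𝓢.deviationExtend B Ψ)
  have h1 : ‖iteratedFDeriv ℝ 0 (𝓢.deviationExtend B Ψ) x‖ₑ ≤ ENNReal.ofReal ε := h0.trans h
  rw [← ofReal_norm, norm_iteratedFDeriv_zero] at h1
  exact (ENNReal.ofReal_le_ofReal_iff hε).mp h1

set_option maxHeartbeats 800000 in
/-- **Core lemma (red-shift rigidity at one instant, label-local).** Fix an EXTREMAL closed label
`|a| = M > 0` (so `r₊ = M`, `Δ = (r − M)²`), a motion `Λ`, and red-shift constants `κ₀, δ > 0`.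
There is `ε = ε(Λ, M, a, κ₀, δ) > 0` such that NO chart `Ψ` of ANY spacetime modelled on the
boosted exterior `(Λ, c, M, a)` can, at any one chart time `τ`, both have red-shift
`κ₀ (r − r₊) ≤ dr(G♯dr)` on the collar slab `{t* = τ, r ≤ r₊ + δ}` (`G = deviationExtend + g_B`,
lab Kerr–Schild coordinates) and be `ε`-close to its label there in `C⁰` (`‖G − g_B‖ ≤ ε` pointwise).
Proof: at the boosted polar point `x = Λ(τ, 0, 0, M + s) + c`, `s = min δ (κ₀M²/2)`, the label value
is `dr(g_B♯ dr) = Δ/Σ = s²/Σ ≤ s²/M² ≤ κ₀ s/2` (`Kerr.bilin_radiusGradVector_self`, `Σ ≥ r²`), the map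
`B ↦ dr(B⁻¹dr)` is continuous at the invertible `g_B(x)` (which, like `dr`, does not depend on
`τ, c`: stationarity), so for `‖G(x) − g_B(x)‖ ≤ ε` one gets `dr(G♯dr) < s²/Σ + κ₀ s/2 ≤ κ₀ s`,
against the red-shift `κ₀ s ≤ dr(G♯dr)`. O'Neill 1995, §2.4–2.5 (`Δ`, `r₊`); DRSR arXiv:1402.7034,
§2.1.1. [folklore] -/
theorem extremal_redShift_near_label_false :
  ∀ (Λ : lorentzGroup) (M a : ℝ), Kerr.IsExtremal M a → ∀ (κ₀ δ : ℝ), 0 < κ₀ → 0 < δ → ∃ ε : ℝ, 0 < ε ∧ ∀ (c : E4) (𝓢 : Spacetime.{0} 4) (Ψ : (boostedKerrBackground Λ c M a).domain → 𝓢.carrier) (τ : ℝ), (∀ x ∈ (boostedKerrBackground Λ c M a).truncTimeSlab (Kerr.rPlus M a + δ) τ, κ₀ * ((boostedKerrBackground Λ c M a).radius x.1 - Kerr.rPlus M a) ≤ (fderiv ℝ (fun y ↦ Kerr.radius a (poincareInv Λ c y)) (x : E4)) (MetricCoord.sharpAt (fun y ↦ 𝓢.deviationExtend (boostedKerrBackground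 Λ c M a) Ψ y + boostedKerrBilin Λ c M a y) (x : E4) (fderiv ℝ (fun y ↦ Kerr.radius a (poincareInv Λ c y)) (x : E4)))) → (∀ x ∈ (boostedKerrBackground Λ c M a).truncTimeSlab (Kerr.rPlus M a + δ) τ, ‖𝓢.deviationExtend (boostedKerrBackground Λ c M a) Ψ x‖ ≤ ε) → False := by
  intro Λ M a hext κ₀ δ hκ₀ hδ
  obtain ⟨haM, hM⟩ := hext
  have hrp : Kerr.rPlus M a = M := KerrSchildChart.rPlus_of_abs_eq haM
  have ha2 : a ^ 2 = M ^ 2 := by rw [← sq_abs, haM]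
  -- the collar depth `s`
  set s : ℝ := min δ (κ₀ * M ^ 2 / 2) with hs_def
  have hs0 : 0 < s := lt_min hδ (by positivity)
  have hsδ : s ≤ δ := min_le_left _ _
  have hsκ : s ≤ κ₀ * M ^ 2 / 2 := min_le_right _ _
  -- the rest-frame polar point `p = (0, 0, 0, M + s)` and the label data there
  set p : E4 := (M + s) • E4.basisVector 3 with hp_def
  have hMs : 0 < M + s := by linarith
  have hrad_p : Kerr.radius a p = M + s := KerrSchildChart.radius_polar a hMs.le
  have hr_pos : 0 < Kerr.radius a p := by rw [hrad_p]; exact hMs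
  set W : E4 := Kerr.radiusGradVector M a p with hW_def
  set A₀ : E4 →L[ℝ] E4 →L[ℝ] ℝ := boostedKerrBilin Λ 0 M a ((Λ : E4 ≃L[ℝ] E4) p) with hA₀_def
  set α₀ : E4 →L[ℝ] ℝ := ((Kerr.radiusGrad a (E4.spatial p)).comp E4.spatial).comp
      ((Λ : E4 ≃L[ℝ] E4).symm : E4 →L[ℝ] E4) with hα₀_def
  -- `A₀` is invertible
  have hp0 : poincareInv Λ 0 ((Λ : E4 ≃L[ℝ] E4) p) = p := by simp [poincareInv]
  have hp_dom : (Λ : E4 ≃L[ℝ] E4) p ∈ boostedKerrExterior Λ 0 M a := by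
    rw [mem_boostedKerrExterior, hp0, Kerr.mem_exterior, hrp, hrad_p]
    exact max_lt (by linarith) hMs
  have hA₀inv : A₀.IsInvertible :=
    (KerrSchildChart.isMetricOn_boostedKerrBilin Λ 0 M a).isInvertible _ hp_dom
  -- `A₀ (ΛW) = α₀`, so `A₀⁻¹ α₀ = ΛW`
  have hA₀W : A₀ ((Λ : E4 ≃L[ℝ] E4) W) = α₀ := by
    ext w
    rw [hA₀_def, boostedKerrBilin_apply, hp0, ContinuousLinearEquiv.symm_apply_apply,
      Kerr.bilin_radiusGradVector hr_pos]
    rfl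
  have hinvα : A₀.inverse α₀ = (Λ : E4 ≃L[ℝ] E4) W := by
    rw [← hA₀W, hA₀inv.inverse_apply_self]
  -- the exact extremal value `α₀ (ΛW) = Δ/Σ = s²/Σ`
  have hval : α₀ ((Λ : E4 ≃L[ℝ] E4) W) = s ^ 2 / Kerr.blSigma a (E4.spatial p) := by
    have h1 : α₀ ((Λ : E4 ≃L[ℝ] E4) W) = Kerr.radiusGrad a (E4.spatial p) (E4.spatial W) := by
      rw [hα₀_def]
      simp
    rw [h1, ← Kerr.bilin_radiusGradVector hr_pos W, hW_def, Kerr.bilin_radiusGradVector_self hr_pos,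
      hrad_p, ha2]
    congr 1
    ring
  -- `Σ ≥ r² = (M + s)²`
  have hp_ts : E4.ofTimeSpace 0 (E4.spatial p) = p := by
    have h := E4.ofTimeSpace_time_spatial p
    have ht : E4.time p = 0 := by
      rw [E4.time_apply, hp_def]
      simp
    rwa [ht] at h
  have hr_pos' : 0 < Kerr.radius a (E4.ofTimeSpace 0 (E4.spatial p)) := by rwa [hp_ts]
  have hSig : (M + s) ^ 2 ≤ Kerr.blSigma a (E4.spatial p) := by
    have h := Kerr.sq_le_blSigma hr_pos'
    rwa [hp_ts, hrad_p] at h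
  have hSigpos : 0 < Kerr.blSigma a (E4.spatial p) := lt_of_lt_of_le (by positivity) hSig
  -- hence `s²/Σ ≤ κ₀ s / 2`
  have hlabel : s ^ 2 / Kerr.blSigma a (E4.spatial p) ≤ κ₀ * s / 2 := by
    have h1 : s ^ 2 / Kerr.blSigma a (E4.spatial p) ≤ s ^ 2 / M ^ 2 :=
      div_le_div_of_nonneg_left (sq_nonneg s) (by positivity) (le_trans (by nlinarith) hSig)
    have h2 : s ^ 2 / M ^ 2 ≤ κ₀ * s / 2 := by
      rw [div_le_iff₀ (by positivity)]
      nlinarith [mul_le_mul_of_nonneg_left hsκ hs0.le]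
    exact h1.trans h2
  -- continuity of `B ↦ α₀(B⁻¹α₀)` at `A₀` with gap `κ₀ s / 2`
  obtain ⟨η, hη, hnear⟩ := exists_inverse_apply_near hA₀inv α₀ (γ := κ₀ * s / 2) (by positivity)
  refine ⟨η / 2, half_pos hη, fun c 𝓢 Ψ τ hRS hsmall ↦ ?_⟩
  -- the orbit point `x = Λ p + c + τ Λe₀`
  set x : E4 := (Λ : E4 ≃L[ℝ] E4) p + c +
    τ • (Λ : E4 ≃L[ℝ] E4) (EuclideanSpace.single (0 : Fin 4) (1 : ℝ)) with hx_def
  have hxdom : x ∈ (boostedKerrBackground Λ c M a).domain :=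
    polarOrbit_mem_domain Λ c ⟨haM, hM⟩ (by linarith : M < M + s) τ
  have htime : (boostedKerrBackground Λ c M a).time x = τ := time_polarOrbit Λ c M a (M + s) τ
  have hradius : (boostedKerrBackground Λ c M a).radius x = M + s :=
    radius_polarOrbit Λ c M a hMs.le τ
  have hAx : boostedKerrBilin Λ c M a x = A₀ := boostedKerrBilin_polarOrbit Λ c M a (M + s) τ
  have hfd : fderiv ℝ (fun y ↦ Kerr.radius a (poincareInv Λ c y)) x = α₀ :=
    fderiv_radius_polarOrbit Λ c a hMs τ
  have hslab : (⟨x, hxdom⟩ : (boostedKerrBackground Λ c M a).domain) ∈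
      (boostedKerrBackground Λ c M a).truncTimeSlab (Kerr.rPlus M a + δ) τ :=
    ⟨htime, by rw [hradius, hrp]; linarith⟩
  have h1 := hRS ⟨x, hxdom⟩ hslab
  have h2 := hsmall ⟨x, hxdom⟩ hslab
  simp only [MetricCoord.sharpAt] at h1
  rw [hradius, hrp, hfd, hAx] at h1
  -- `h1 : κ₀ ((M + s) − M) ≤ α₀ ((dev x + A₀)⁻¹ α₀)`
  set Dx := 𝓢.deviationExtend (boostedKerrBackground Λ c M a) Ψ x with hDx_def
  have hdist : ‖(Dx + A₀) - A₀‖ < η := by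
    rw [show Dx + A₀ - A₀ = Dx by abel]
    exact h2.trans_lt (half_lt_self hη)
  have h3 := hnear (Dx + A₀) hdist
  rw [hinvα, hval] at h3
  have h4 := (abs_lt.mp h3).2
  nlinarith [h1, h4, hlabel, hs0, hκ₀]


end Summit.FinalStateConjecture.FinalStateConjecture.Theorems.ClusterCompleteness

end
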